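import Literature.Computability.QuantumComplexity.BlockSensitivityQuantumBound
import HarnessLib

/-!
# Bounded low-degree approximants force small block sensitivity and certificate complexity (Nisan–Szegedy; Fenner–Fortnow–Kurtz–Li Thm. 6.11)

Topic `Literature/Computability/Complexity` (Boolean-function complexity measures of
`BlockSensitivity.lean`), companion of `QuantumComplexity/BlockSensitivityQuantumBound.lean`.

Fenner–Fortnow–Kurtz–Li, *An oracle builder's toolkit*, Inform. and Comput. 182 (2003),
**Thm. 6.11 (Nisan–Szegedy)**, p. 30: "There is a fixed polynomial `c` such that, if
1. `f(x₁, …, x_N)` is a Boolean function, 2. `p(x₁, …, x_N)` is a polynomial with real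
coefficients of degree `d`, and 3. for all `⟨x₁, …, x_N⟩ ∈ {0,1}^N`, `|f(x) - p(x)| ≤ 1/3`, then
`f` has certificate complexity bounded by `c(d)`." This is the step by which `AWPP` (a `GapP`
function `h` with `h(y)/2^{q(n)} ∈ [0, 1/3] ∪ [2/3, 1]`, a polynomial of degree `≤ nᵏ` in the
oracle bits by their Lemma 6.12) gets polynomial certificate complexity (Thm. 6.13), whence the
generic-oracle collapse `AWPP^G = P^G` (Cor. 6.14, Thm. 6.18 (2)) behind Fortnow–Rogers'
Cor. 3.7 (`Literature/Barriers/QuantumAdvantage/FortnowRogersOracle.lean`,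
`fennerFortnowKurtzLi2003_thm618_awpp`).

The tree already PROVES the analytic core for approximants with values in `[0, 1]` (the case of
acceptance probabilities and of the `AWPP` quotients `h/2^q`): Beals–Buhrman–Cleve–Mosca–de Wolf
2001, proof of Thm. 4.13 — symmetrization (`Symmetrization.lean`), Markov's inequality and the
Ehlich–Zeller / Rivlin–Cheney lemma (`Literature/Analysis/Approximation/`), assembled as
`card_le_four_mul_sq_of_approx` (`BlockSensitivityQuantumBound.lean`: `b` disjoint sensitive
blocks against such an approximant of total degree `≤ d` force `b ≤ 4d²`) — and Nisan's
`C(f) ≤ bs(f)²` (`certificateComplexity_le_sq`, `BlockSensitivity.lean`). This file records the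
resulting POLYNOMIAL form of Thm. 6.11 for `[0,1]`-valued approximants, with the explicit
`c(d) = 16 d⁴`:

* `blockSensitivity_le_four_mul_sq_of_approx` — `bs(f) ≤ 4 d²`;
* `certificateComplexity_le_of_approx` — `C(f) ≤ 16 d⁴`;
* `certificateComplexityAt_le_of_approx` — every input has a certificate of size `≤ 16 d⁴`
  (the form consumed by certificate-search algorithms).

The general printed hypothesis (no `[0,1]` bound on `p`) differs only in constants (replace `p`
by a clipped affine image; not needed downstream and not done here).

## References

* [FennerFortnowKurtzLi2003IC] S. Fenner, L. Fortnow, S. Kurtz, L. Li, Inform. and Comput. 182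
  (2003), Thm. 6.11 (p. 30), Lemma 6.12, Thm. 6.13 (pp. 31–32), read via
  `lit read doi:10.1016/s0890-5401(03)00018-x --pages 25-34`.
* [BealsEtAl2001] R. Beals, H. Buhrman, R. Cleve, M. Mosca, R. de Wolf, J. ACM 48 (2001),
  Thm. 4.13 (proof) and Lemma 5.2 (the tree's `card_le_four_mul_sq_of_approx`,
  `certificateComplexity_le_sq`).
* N. Nisan, M. Szegedy, *On the degree of Boolean functions as real polynomials*, Comput.
  Complexity 4 (1994) 301–313 (original source of `bs(f) = O(deg̃(f)²)`).
-/

namespace Literature.Computability.Complexity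

open MvPolynomial Finset Literature.Computability.QuantumComplexity

/-- **Nisan–Szegedy (Fenner–Fortnow–Kurtz–Li Thm. 6.11), block-sensitivity form**: if a real
polynomial `P` of total degree `≤ d` takes values in `[0,1]` on the Boolean cube, is `≤ 1/3`
wherever `f = 0` and `≥ 2/3` wherever `f = 1`, then `bs(f) ≤ 4 d²`. (Beals et al.'s proof of
Thm. 4.13 with the acceptance polynomial replaced by `P`: at the input achieving `bs(f)` use `P`
if `f = 0` there and `1 - P` otherwise.) [cite: FennerFortnowKurtzLi2003IC, Thm. 6.11 (p. 30)] [cite: BealsEtAl2001, Thm 4.13 (proof)] -/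
theorem blockSensitivity_le_four_mul_sq_of_approx {N d : ℕ} (f : (Fin N → Bool) → Bool)
    (P : MvPolynomial (Fin N) ℝ) (hdeg : P.totalDegree ≤ d)
    (h01 : ∀ z : Fin N → Bool, 0 ≤ MvPolynomial.eval (Multilinear.boolPt (R := ℝ) z) P ∧
      MvPolynomial.eval (Multilinear.boolPt (R := ℝ) z) P ≤ 1)
    (h0 : ∀ z : Fin N → Bool, f z = false → MvPolynomial.eval (Multilinear.boolPt (R := ℝ) z) P ≤ 1 / 3)
    (h1 : ∀ z : Fin N → Bool, f z = true → 2 / 3 ≤ MvPolynomial.eval (Multilinear.boolPt (R := ℝ) z) P) :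
    blockSensitivity f ≤ 4 * d ^ 2 := by
  classical
  obtain ⟨x, B, hsens, hdisj⟩ := exists_blocks_of_blockSensitivity f
  rcases Nat.eq_zero_or_pos (blockSensitivity f) with hb0 | hb1
  · rw [hb0]; exact Nat.zero_le _
  cases hfx : f x
  · -- `f x = false`: use `P`
    refine card_le_four_mul_sq_of_approx x hdisj P hdeg h01 (h0 x hfx) (fun j => ?_) hb1
    have hfj : f (flipBlock x (B j)) = true := by
      have := hsens j; rw [hfx] at this; simpa using this
    exact h1 _ hfj
  · -- `f x = true`: use `1 - P`
    refine card_le_four_mul_sq_of_approx x hdisj (1 - P) ?_ ?_ ?_ ?_ hb1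
    · exact (totalDegree_sub _ _).trans (max_le (by simp) hdeg)
    · intro z
      simp only [map_sub, map_one]
      constructor <;> linarith [(h01 z).1, (h01 z).2]
    · simp only [map_sub, map_one]
      linarith [h1 x hfx]
    · intro j
      have hfj : f (flipBlock x (B j)) = false := by
        have := hsens j; rw [hfx] at this; simpa using this
      simp only [map_sub, map_one]
      linarith [h0 _ hfj]

/-- **Nisan–Szegedy (Fenner–Fortnow–Kurtz–Li Thm. 6.11): a `[0,1]`-valued approximant of total
degree `≤ d` gives certificate complexity `C(f) ≤ 16 d⁴`** (`C(f) ≤ bs(f)² ≤ (4d²)²`). This is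
the polynomial `c(d)` of "AWPP has polynomial certificate complexity" (their Thm. 6.13).
[cite: FennerFortnowKurtzLi2003IC, Thm. 6.11 (p. 30) and Thm. 6.13 (pp. 31–32)] [cite: BealsEtAl2001, Lemma 5.2] -/
theorem certificateComplexity_le_of_approx {N d : ℕ} (f : (Fin N → Bool) → Bool)
    (P : MvPolynomial (Fin N) ℝ) (hdeg : P.totalDegree ≤ d)
    (h01 : ∀ z : Fin N → Bool, 0 ≤ MvPolynomial.eval (Multilinear.boolPt (R := ℝ) z) P ∧
      MvPolynomial.eval (Multilinear.boolPt (R := ℝ) z) P ≤ 1)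
    (h0 : ∀ z : Fin N → Bool, f z = false → MvPolynomial.eval (Multilinear.boolPt (R := ℝ) z) P ≤ 1 / 3)
    (h1 : ∀ z : Fin N → Bool, f z = true → 2 / 3 ≤ MvPolynomial.eval (Multilinear.boolPt (R := ℝ) z) P) :
    certificateComplexity f ≤ 16 * d ^ 4 := by
  have hbs := blockSensitivity_le_four_mul_sq_of_approx f P hdeg h01 h0 h1
  calc certificateComplexity f ≤ blockSensitivity f ^ 2 := certificateComplexity_le_sq f
    _ ≤ (4 * d ^ 2) ^ 2 := Nat.pow_le_pow_left hbs 2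
    _ = 16 * d ^ 4 := by ring

/-- The same at every input: each `x` has an `f(x)`-certificate of size at most `16 d⁴`
(`C_x(f) ≤ C(f)`). [cite: FennerFortnowKurtzLi2003IC, Thm. 6.11 (p. 30)] -/
theorem certificateComplexityAt_le_of_approx {N d : ℕ} (f : (Fin N → Bool) → Bool)
    (P : MvPolynomial (Fin N) ℝ) (hdeg : P.totalDegree ≤ d)
    (h01 : ∀ z : Fin N → Bool, 0 ≤ MvPolynomial.eval (Multilinear.boolPt (R := ℝ) z) P ∧
      MvPolynomial.eval (Multilinear.boolPt (R := ℝ) z) P ≤ 1)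
    (h0 : ∀ z : Fin N → Bool, f z = false → MvPolynomial.eval (Multilinear.boolPt (R := ℝ) z) P ≤ 1 / 3)
    (h1 : ∀ z : Fin N → Bool, f z = true → 2 / 3 ≤ MvPolynomial.eval (Multilinear.boolPt (R := ℝ) z) P)
    (x : Fin N → Bool) : certificateComplexityAt f x ≤ 16 * d ^ 4 :=
  (certificateComplexityAt_le f x).trans (certificateComplexity_le_of_approx f P hdeg h01 h0 h1)

/-- Hence an explicit small certificate at every input: a set `S` of at most `16 d⁴` variables
such that every input agreeing with `x` on `S` has the same `f`-value.
[cite: FennerFortnowKurtzLi2003IC, Thm. 6.11 (p. 30)] [cite: BealsEtAl2001, Def 5.1] -/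
theorem exists_certificate_of_approx {N d : ℕ} (f : (Fin N → Bool) → Bool)
    (P : MvPolynomial (Fin N) ℝ) (hdeg : P.totalDegree ≤ d)
    (h01 : ∀ z : Fin N → Bool, 0 ≤ MvPolynomial.eval (Multilinear.boolPt (R := ℝ) z) P ∧
      MvPolynomial.eval (Multilinear.boolPt (R := ℝ) z) P ≤ 1)
    (h0 : ∀ z : Fin N → Bool, f z = false → MvPolynomial.eval (Multilinear.boolPt (R := ℝ) z) P ≤ 1 / 3)
    (h1 : ∀ z : Fin N → Bool, f z = true → 2 / 3 ≤ MvPolynomial.eval (Multilinear.boolPt (R := ℝ) z) P)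
    (x : Fin N → Bool) : ∃ S : Finset (Fin N), IsCertificate f x S ∧ S.card ≤ 16 * d ^ 4 := by
  obtain ⟨S, hS, hcard⟩ := exists_certificate_card_eq f x
  exact ⟨S, hS, hcard ▸ certificateComplexityAt_le_of_approx f P hdeg h01 h0 h1 x⟩

end Literature.Computability.Complexity
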